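import Literature.Geometry.Lorentzian.ChartConnection
import Literature.Geometry.Lorentzian.CurvatureRegularity
import HarnessLib

/-!
# The Ricci and scalar curvature of a metric on an open subset of a normed space, in a basis

Support file (all results proved) for Bartnik's existence theorem for the ADM energy
(`Literature.Geometry.Lorentzian.AFEnd.HasADMEnergy_of_isAsymptoticallyFlat`): the scalar
curvature of the pulled-back metric on `{R < ‖x‖} ⊆ ℝ³` as an explicit polynomial in the inverse
Gram matrix, the first derivatives (quadratically) and the second derivatives (linearly) of the
metric components.

Pointwise linear algebra for a pseudo-Riemannian metric `g'` on a bundle and a basis `β` of a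
fibre (Gram matrix `𝒢ᵢⱼ = g'(βᵢ, βⱼ)`, inverse `𝒢⁻¹`):

* `trace_eq_sum_gram_inv_val` — `tr T = ∑ᵢⱼ (𝒢⁻¹)ⱼᵢ g'(T βᵢ, βⱼ)` for an endomorphism `T`;
* `sharp_eq_sum` — `♯α = ∑ₐ (∑_c (𝒢⁻¹)_{ca} α(β_c)) βₐ`, `val_sharp_sharp_eq_sum` —
  `g'(♯α, ♯α') = ∑_{a,c} (𝒢⁻¹)_{ca} α'(β_c) α(βₐ)`;
* `ricci_eq_sum` — `Ric(Y₀, Z₀) = ∑ᵢⱼ (𝒢⁻¹)ⱼᵢ g(R(βᵢ, Y₀) Z₀, βⱼ)`;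
* `scalarCurvature_eq_sum` — `S = ∑_{kl} (𝒢⁻¹)_{lk} Ric(β_k, β_l)`.

Then, for a smooth metric `g` on `U : Opens E` with representative `G` (`ChartCalculus`,
`ChartConnection`):

* `val_christoffel_christoffel_eq_sum` — `g(Γ(Z)(Y), Γ(W)(X)) = ∑_{a,c} (𝒢⁻¹)_{ca} ½K(W,X,β_c) ½K(Z,Y,βₐ)`;
* `scalarCurvature_eq_coord` — **the scalar curvature in coordinates**:
  `S(x) = ∑_{kl} (𝒢⁻¹)_{lk} ∑_{ij} (𝒢⁻¹)_{ji} [½(∂_{βᵢ} K(β_l,β_k,βⱼ) − ∂_{β_k} K(β_l,βᵢ,βⱼ))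
            − ∑_{ac} (𝒢⁻¹)_{ca} ½K(βⱼ,βᵢ,β_c) ½K(β_l,β_k,βₐ) + ∑_{ac} (𝒢⁻¹)_{ca} ½K(βⱼ,β_k,β_c) ½K(β_l,βᵢ,βₐ)]`
  (O'Neill 1983, Ch. 3, Lemma 3.38 and Def. 3.53: `S = g^{jk} R^i_{jik}` with
  `R = ∂Γ − ∂Γ + ΓΓ − ΓΓ`, `Γ` of the first kind `½K`).

## References

* B. O'Neill, *Semi-Riemannian geometry* (1983), Ch. 3, pp. 60–61, Lemma 3.38, Lemma 3.52,
  Def. 3.53.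
-/

noncomputable section

open Bundle Set Function Filter ContinuousLinearMap TopologicalSpace
open scoped Manifold ContDiff Topology

namespace Literature.Geometry.Lorentzian

/-! ### Pointwise linear algebra in a basis of a fibre -/

section Fibre

variable {EB : Type*} [NormedAddCommGroup EB] [NormedSpace ℝ EB]
  {HB : Type*} [TopologicalSpace HB] {B : Type*} [TopologicalSpace B] [ChartedSpace HB B]
  {IB : ModelWithCorners ℝ EB HB} {n' : ℕ∞ω}
  {F' : Type*} [NormedAddCommGroup F'] [NormedSpace ℝ F'] {V : B → Type*}
  [TopologicalSpace (TotalSpace F' V)] [∀ b, TopologicalSpace (V b)] [∀ b, AddCommGroup (V b)]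
  [∀ b, Module ℝ (V b)] [FiberBundle F' V] [VectorBundle ℝ F' V] [FiniteDimensional ℝ F']
  {ι : Type*} [Fintype ι] [DecidableEq ι]

/-- **The trace of an endomorphism through the metric**: `tr T = ∑ᵢⱼ (𝒢⁻¹)ⱼᵢ g(T βᵢ, βⱼ)` with
`𝒢` the Gram matrix of the basis `β` (the metric trace of the bilinear form `(v, w) ↦ g(T v, w)`,
whose `♯`-image is `T`; O'Neill 1983, Ch. 3, pp. 60–61). [cite: ONeill1983, Ch. 3, pp. 60–61] -/
theorem trace_eq_sum_gram_inv_val (g' : PseudoRiemannianMetric IB n' F' V) (b : B)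
    (β : Module.Basis ι ℝ (V b)) (T : V b →ₗ[ℝ] V b) :
    LinearMap.trace ℝ (V b) T =
      ∑ i, ∑ j, (Matrix.of fun i j ↦ g'.val b (β i) (β j))⁻¹ j i * g'.val b (T (β i)) (β j) := by
  -- the bilinear form `(v, w) ↦ g(T v, w)` and its `♯`-image
  set BT : LinearMap.BilinForm ℝ (V b) := (g'.toBilinForm b).comp T LinearMap.id with hBT
  have hBT_apply : ∀ v w, BT v w = g'.val b (T v) w := fun v w ↦ rfl
  have hsharp : (g'.sharp b).toLinearMap ∘ₗ BT = T := by
    ext v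
    rw [LinearMap.comp_apply, LinearEquiv.coe_coe]
    refine g'.sharp_eq_of_forall b (BT v) (T v) fun w ↦ ?_
    rw [hBT_apply]
  have htr : LinearMap.trace ℝ (V b) T = g'.trace b BT := by
    rw [PseudoRiemannianMetric.trace, hsharp]
  rw [htr, trace_eq_sum_gram_inv g' b β BT]
  simp only [hBT_apply]

/-- **Index raising in a basis**: `♯α = ∑ₐ (∑_c (𝒢⁻¹)_{ca} α(β_c)) βₐ` (O'Neill 1983, Ch. 3,
p. 60: `(♯α)^a = g^{ac} α_c`, via `gram_inv_eq`). [cite: ONeill1983, Ch. 3, p. 60] -/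
theorem sharp_eq_sum (g' : PseudoRiemannianMetric IB n' F' V) (b : B) (β : Module.Basis ι ℝ (V b))
    (α : Module.Dual ℝ (V b)) :
    g'.sharp b α =
      ∑ a, (∑ c, (Matrix.of fun i j ↦ g'.val b (β i) (β j))⁻¹ c a * α (β c)) • β a := by
  rw [gram_inv_eq]
  simp only [Matrix.transpose_apply, Matrix.of_apply]
  conv_lhs => rw [← β.sum_repr (g'.sharp b α)]
  refine Finset.sum_congr rfl fun a _ ↦ ?_
  congr 1
  have hα : α = ∑ c, α (β c) • β.coord c := (β.sum_dual_apply_smul_coord α).symm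
  rw [show β.repr (g'.sharp b α) a = β.coord a (g'.sharp b α) from rfl]
  conv_lhs => rw [hα]
  rw [map_sum, map_sum]
  refine Finset.sum_congr rfl fun c _ ↦ ?_
  rw [map_smul, map_smul, smul_eq_mul, mul_comm]

/-- **The metric on raised covectors in a basis**: `g(♯α, ♯α') = ∑_{a,c} (𝒢⁻¹)_{ca} α'(β_c) α(βₐ)`
(O'Neill 1983, Ch. 3, p. 60: `g^{ac} α'_c α_a`). [cite: ONeill1983, Ch. 3, p. 60] -/
theorem val_sharp_sharp_eq_sum (g' : PseudoRiemannianMetric IB n' F' V) (b : B)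
    (β : Module.Basis ι ℝ (V b)) (α α' : Module.Dual ℝ (V b)) :
    g'.val b (g'.sharp b α) (g'.sharp b α') =
      ∑ a, ∑ c, (Matrix.of fun i j ↦ g'.val b (β i) (β j))⁻¹ c a * α' (β c) * α (β a) := by
  rw [g'.val_sharp_apply, sharp_eq_sum g' b β α', map_sum]
  refine Finset.sum_congr rfl fun a _ ↦ ?_
  rw [map_smul, smul_eq_mul, Finset.sum_mul]

end Fibre

/-! ### The Ricci and scalar curvature in a basis (any manifold) -/

namespace PseudoRiemannianMetric

variable {E : Type*} [NormedAddCommGroup E] [NormedSpace ℝ E] {H : Type*} [TopologicalSpace H]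
  {I : ModelWithCorners ℝ E H} {M : Type*} [TopologicalSpace M] [ChartedSpace H M]
  [IsManifold I ∞ M] {n : ℕ∞ω} [Fact (1 ≤ n)] [FiniteDimensional ℝ E] [CompleteSpace E]
  (g : PseudoRiemannianMetric I n E (TangentSpace I : M → Type _)) [g.HasLeviCivita]
  {ι : Type*} [Fintype ι] [DecidableEq ι]

omit [Fact (1 ≤ n)] [CompleteSpace E] in
/-- **The Ricci tensor in a basis**: `Ric_x(Y₀, Z₀) = ∑ᵢⱼ (𝒢⁻¹)ⱼᵢ g_x(R(βᵢ, Y₀) Z₀, βⱼ)`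
(O'Neill 1983, Ch. 3, Lemma 3.52: `Ric = C¹₃ R`, the metric form of the trace `v ↦ R(v, Y₀) Z₀`).
[cite: ONeill1983, Ch. 3, Lemma 3.52] -/
theorem ricci_eq_sum (x : M) (β : Module.Basis ι ℝ (TangentSpace I x)) (Y₀ Z₀ : TangentSpace I x) :
    g.ricci x Y₀ Z₀ = ∑ i, ∑ j, (Matrix.of fun i j ↦ g.val x (β i) (β j))⁻¹ j i *
      g.val x (g.riemann x (β i) Y₀ Z₀) (β j) := by
  rw [ricci_apply, CovariantDerivative.ricci_apply, trace_eq_sum_gram_inv_val g x β]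
  rfl

omit [Fact (1 ≤ n)] [CompleteSpace E] in
/-- **The scalar curvature in a basis**: `S(x) = ∑_{kl} (𝒢⁻¹)_{lk} Ric_x(β_k, β_l)`
(O'Neill 1983, Ch. 3, Def. 3.53: `S = C Ric = g^{kl} Ric_{kl}`). [cite: ONeill1983, Ch. 3, Def. 3.53] -/
theorem scalarCurvature_eq_sum (x : M) (β : Module.Basis ι ℝ (TangentSpace I x)) :
    g.scalarCurvature x =
      ∑ k, ∑ l, (Matrix.of fun i j ↦ g.val x (β i) (β j))⁻¹ l k * g.ricci x (β k) (β l) :=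
  trace_eq_sum_gram_inv g x β (g.ricci x)

end PseudoRiemannianMetric

/-! ### The scalar curvature of a metric on `U : Opens E` in coordinates -/

namespace OpensChart

variable {E : Type*} [NormedAddCommGroup E] [NormedSpace ℝ E] [FiniteDimensional ℝ E]
  [CompleteSpace E] {U : Opens E}
  {g : PseudoRiemannianMetric 𝓘(ℝ, E) ∞ E (TangentSpace 𝓘(ℝ, E) : U → Type _)}
  {G : E → E →L[ℝ] E →L[ℝ] ℝ} (hG : ∀ y : U, g.val y = G y)
  {ι : Type*} [Fintype ι] [DecidableEq ι]

include hG

omit [CompleteSpace E] in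
/-- **The `ΓΓ` terms in a basis**: `g_x(Γ(Z)(Y), Γ(W)(X)) = ∑_{a,c} (𝒢⁻¹)_{ca} ½K(W,X,β_c) ½K(Z,Y,βₐ)`
with `K = koszulForm G x` and `𝒢ᵢⱼ = G x βᵢ βⱼ` (both Christoffel maps are `♯` of `½K`;
`val_sharp_sharp_eq_sum`). O'Neill 1983, Ch. 3, Prop. 3.13 (2) and p. 60.
[cite: ONeill1983, Ch. 3, Prop. 3.13] -/
theorem val_christoffel_christoffel_eq_sum (x : U) (β : Module.Basis ι ℝ (TangentSpace 𝓘(ℝ, E) x))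
    (Z Y W X : E) :
    g.val x (christoffel g G x Z Y) (christoffel g G x W X) =
      ∑ a, ∑ c, (Matrix.of fun i j ↦ G x (β i) (β j))⁻¹ c a *
        (2⁻¹ * koszulForm G x W X (β c)) * (2⁻¹ * koszulForm G x Z Y (β a)) := by
  rw [christoffel_apply, christoffel_apply]
  have h := val_sharp_sharp_eq_sum g x β ((2 : ℝ)⁻¹ • koszulForm G (x : E) Z Y)
    ((2 : ℝ)⁻¹ • koszulForm G (x : E) W X)
  rw [h]
  have hval : ∀ v w : E, g.val x v w = G x v w := fun v w ↦ by
    rw [hG]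
    rfl
  refine Finset.sum_congr rfl fun a _ ↦ Finset.sum_congr rfl fun c _ ↦ ?_
  simp only [hval]
  rfl

/-- **The scalar curvature in coordinates** (O'Neill 1983, Ch. 3, Lemma 3.38 with Lemma 3.52
and Def. 3.53). For a smooth metric on `U : Opens E` with representative `G`, a basis `β` of
`E`, Gram matrix `𝒢ᵢⱼ(x) = G x βᵢ βⱼ` and Koszul form `K(Z,Y,W)(y) = koszulForm G y Z Y W`:
`S(x) = ∑_{kl} (𝒢⁻¹)_{lk} ∑_{ij} (𝒢⁻¹)_{ji} [½(∂_{βᵢ} K(β_l,β_k,βⱼ) − ∂_{β_k} K(β_l,βᵢ,βⱼ))(x)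
        − ∑_{ac} (𝒢⁻¹)_{ca} ½K(βⱼ,βᵢ,β_c) ½K(β_l,β_k,βₐ) + ∑_{ac} (𝒢⁻¹)_{ca} ½K(βⱼ,β_k,β_c) ½K(β_l,βᵢ,βₐ)]`
— `S = g^{kl} Ric_{kl}`, `Ric_{kl} = g^{ij} g(R(βᵢ,β_k)β_l, βⱼ)` and `val_riemann_eq`.
[cite: ONeill1983, Ch. 3, Lemma 3.38 and Def. 3.53] -/
theorem scalarCurvature_eq_coord [g.HasLeviCivita] (x : U)
    (β : Module.Basis ι ℝ (TangentSpace 𝓘(ℝ, E) x)) :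
    g.scalarCurvature x =
      ∑ k, ∑ l, (Matrix.of fun i j ↦ G x (β i) (β j))⁻¹ l k *
        ∑ i, ∑ j, (Matrix.of fun i j ↦ G x (β i) (β j))⁻¹ j i *
          (2⁻¹ * (fderiv ℝ (fun y ↦ koszulForm G y (β l) (β k) (β j)) x (β i)
              - fderiv ℝ (fun y ↦ koszulForm G y (β l) (β i) (β j)) x (β k))
            - ∑ a, ∑ c, (Matrix.of fun i j ↦ G x (β i) (β j))⁻¹ c a *
                (2⁻¹ * koszulForm G x (β j) (β i) (β c)) * (2⁻¹ * koszulForm G x (β l) (β k) (β a))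
            + ∑ a, ∑ c, (Matrix.of fun i j ↦ G x (β i) (β j))⁻¹ c a *
                (2⁻¹ * koszulForm G x (β j) (β k) (β c)) * (2⁻¹ * koszulForm G x (β l) (β i) (β a))) := by
  have hval : ∀ v w : E, g.val x v w = G x v w := fun v w ↦ by
    rw [hG]
    rfl
  have hgram : (Matrix.of fun i j ↦ g.val x (β i) (β j)) = Matrix.of fun i j ↦ G x (β i) (β j) := by
    ext i j
    exact hval (β i) (β j)
  rw [PseudoRiemannianMetric.scalarCurvature_eq_sum g x β, hgram]
  refine Finset.sum_congr rfl fun k _ ↦ Finset.sum_congr rfl fun l _ ↦ ?_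
  congr 1
  rw [PseudoRiemannianMetric.ricci_eq_sum g x β, hgram]
  refine Finset.sum_congr rfl fun i _ ↦ Finset.sum_congr rfl fun j _ ↦ ?_
  congr 1
  rw [val_riemann_eq hG x (β i) (β k) (β l) (β j), val_christoffel_christoffel_eq_sum hG x β,
    val_christoffel_christoffel_eq_sum hG x β]

end OpensChart

end Literature.Geometry.Lorentzian

end
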